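import Summits.SmoothPoincare4.SmoothPoincare4.Theorems.SoloInformedPinnedSlopeCertificate
import Summits.SmoothPoincare4.SmoothPoincare4.Theorems.SoloInformedPinnedSlopeCertificateC

/-!
# Canonical-quotient certificates: `G_w = π₁(N_{x_*}(γ_w)) / ⟪e⟫` is non-commutative

Solo residency `solo-SmoothPoincare4-informed`, session 15; algebraic core of COMPUTATION 11.48 /
LEMMA 11.49(d) / REMARK 11.50(iii) of the residency file `paper/poincare-sphere-trick.md` §11.10
(prose results under adjudication, not theorems of this tree). It REUSES the landed pinned-slope
certificates: the machinery (`W`, `evalP`, `G`, `of_mul_of_ne`; namespace `PinnedSlope`) and, for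
each word, the thirteen relators `R_w` of `π₁(N_{x_*}(γ_w))`, the representation `f_w` into `S₅`,
`rels_w` and `nc_w` (`SoloInformedPinnedSlopeCertificate.lean`, `…CertificateC.lean`); new here are
only the additional relators and the observation that the SAME representations kill them.

Geometric provenance (prose + machine computation, not formalised here). For a door-(a) section
word `w` with `|ε(w)| = b(w) = 1`, at the unique homologically admissible slope `x_*` the filling
`N_{x_*}(γ_w)` is the exterior of a ONE-SIDED knot `κ_w ⊂ S¹ ×~ S²` whose orientation cover is the
exterior `V` of a generator-class knot `C_w ⊂ S¹ × S²` (COROLLARY 11.43); door (a) for `w` ⟺ `C_w`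
is not a core. The boundary Klein bottle has `π₁ = ⟨y, m ∣ y m y⁻¹ = m⁻¹⟩`; `e := y²`, its unique
two-sided separating class, lifts to the deck-invariant framing of `C_w` (LEMMA 11.46), and
`G_w := π₁(N_{x_*}(γ_w)) / ⟪e⟫ ≅ π₁(Σ^ι_w) ⋊ C₂` is the orbifold fundamental group of the quotient
of the canonical homology sphere `Σ^ι_w = V(e)` by the extended involution (REMARK 11.50); door (a)
⟺ `Σ^ι_w ≇ S³` ⟺ `G_w ≠ ℤ/2`. The word `e_w = (g⁻¹ y)²` below (the square of the peripheral
one-sided class `g⁻¹ y`, in the generators `a, …, e, y` of the pinned-slope certificates) and, for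
`w = SStts`, the normalised longitude `λ₀` (equal to `e` in the group: COMPUTATION 11.48, `j = 0`)
are the output of the residency scripts `work/s15/cert/gen_cert.py`, `work/s15/job_reps2/driver.py`,
taken here as INPUT. What is kernel-checked: the landed representation `f_w` kills the new
relators too (`decide`), so `G_w` maps to `S₅` with two non-commuting generator images, hence is
non-commutative and not isomorphic to any commutative group (in particular not to `ℤ/2`). That
every `S₅`-representation of `π₁(N_{x_*}(γ_w))` with `ρ(m̃)` of order 3 or 5 kills `e` is LEMMA 11.49
(Klein descent; group theory in `SoloInformedKleinDescent.lean`). One word of each of the three isomorphism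
types of short door-(a) words is certified: `SStts`, `SSSStss`, `SSTStts`.
-/

set_option maxRecDepth 20000

namespace Summit.SmoothPoincare4.SmoothPoincare4.Theorems
namespace CanonicalQuotient

open PinnedSlope PinnedSlopeC

/-- A presented group with two non-commuting generator images in `S₅` is not isomorphic to any
commutative group. -/
theorem isEmpty_mulEquiv_comm (R : List W) (f : Fin 6 → Equiv.Perm (Fin 5))
    (h : ∀ L ∈ R, evalP f L = 1) (i j : Fin 6) (hij : f i * f j ≠ f j * f i)
    (A : Type*) [CommGroup A] : IsEmpty (G R ≃* A) := by
  refine ⟨fun q => of_mul_of_ne R f h i j hij ?_⟩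
  apply q.injective
  rw [map_mul, map_mul, mul_comm]

/-- Relators of an extended list hold if the old ones do and the new ones do. -/
theorem evalP_of_mem_append (R S : List W) (f : Fin 6 → Equiv.Perm (Fin 5))
    (hR : ∀ L ∈ R, evalP f L = 1) (hS : ∀ L ∈ S, evalP f L = 1) :
    ∀ L ∈ R ++ S, evalP f L = 1 := by
  intro L hL
  rcases List.mem_append.mp hL with h | h
  · exact hR L h
  · exact hS L h

/-! ## The canonical quotients -/

/-- The normalised longitude `λ₀` of `C_w`, `w = SStts` (length 26). -/
def lam0_SStts : W :=
  [A, b, c, D, B, d, e, A, b, c, D, D, e, B, a, E, d, C, E, b, D, e, A, b, A, b]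

/-- `e_w = (g⁻¹y)²`, `w = SStts` (length 14): the ι-invariant framing of `C_w`. -/
def e_SStts : W :=
  [B, a, E, d, B, e, y, B, a, E, d, B, e, y]

/-- The new relators for `w = SStts`. -/
def S_SStts : List W := [lam0_SStts, e_SStts]

/-- Relators of `G_w = π₁(N_{x_*}(γ_w)) / ⟪e⟫`, `w = SStts`:
the landed `R_SStts`, then `S_SStts`. -/
def RG_SStts : List W := R_SStts ++ S_SStts

/-- The landed representation `f_SStts` kills the new relators. -/
theorem relsS_SStts : ∀ L ∈ S_SStts, evalP f_SStts L = 1 := by decide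

/-- … hence all relators of `RG_SStts`. -/
theorem relsG_SStts : ∀ L ∈ RG_SStts, evalP f_SStts L = 1 :=
  evalP_of_mem_append R_SStts S_SStts f_SStts rels_SStts relsS_SStts

/-- MAIN (SStts): the canonical quotient `G_w`, `w = SStts`, is non-commutative — in particular
not `ℤ/2`, so the canonical homology sphere `Σ^ι_w` is not `S³` (REMARK 11.50(iii) of the
residency file). -/
theorem not_comm_G_SStts :
    (PresentedGroup.of 2 : G RG_SStts) * PresentedGroup.of 3 ≠
      PresentedGroup.of 3 * PresentedGroup.of 2 :=
  of_mul_of_ne RG_SStts f_SStts relsG_SStts 2 3 nc_SStts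

/-- … hence `G_w` (`w = SStts`) is not isomorphic to any commutative group (e.g. `ℤ/2`). -/
theorem isEmpty_G_SStts_mulEquiv_comm (A : Type*) [CommGroup A] :
    IsEmpty (G RG_SStts ≃* A) :=
  isEmpty_mulEquiv_comm RG_SStts f_SStts relsG_SStts 2 3 nc_SStts A

/-- `e_w = (g⁻¹y)²`, `w = SSSStss` (length 38): the ι-invariant framing of `C_w`. -/
def e_SSSStss : W :=
  [B, a, E, B, e, c, D, e, d, C, E, b, e, B, a, E, B, e, y, B, a, E, B, e, c, D, e, d, C, E, b,
   e, B, a, E, B, e, y]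

/-- The new relator for `w = SSSStss`. -/
def S_SSSStss : List W := [e_SSSStss]

/-- Relators of `G_w = π₁(N_{x_*}(γ_w)) / ⟪e⟫`, `w = SSSStss`:
the landed `R_SSSStss`, then `S_SSSStss`. -/
def RG_SSSStss : List W := R_SSSStss ++ S_SSSStss

/-- The landed representation `f_SSSStss` kills the new relators. -/
theorem relsS_SSSStss : ∀ L ∈ S_SSSStss, evalP f_SSSStss L = 1 := by decide

/-- … hence all relators of `RG_SSSStss`. -/
theorem relsG_SSSStss : ∀ L ∈ RG_SSSStss, evalP f_SSSStss L = 1 :=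
  evalP_of_mem_append R_SSSStss S_SSSStss f_SSSStss rels_SSSStss relsS_SSSStss

/-- MAIN (SSSStss): the canonical quotient `G_w`, `w = SSSStss`, is non-commutative — in particular
not `ℤ/2`, so the canonical homology sphere `Σ^ι_w` is not `S³` (REMARK 11.50(iii) of the
residency file). -/
theorem not_comm_G_SSSStss :
    (PresentedGroup.of 2 : G RG_SSSStss) * PresentedGroup.of 3 ≠
      PresentedGroup.of 3 * PresentedGroup.of 2 :=
  of_mul_of_ne RG_SSSStss f_SSSStss relsG_SSSStss 2 3 nc_SSSStss

/-- … hence `G_w` (`w = SSSStss`) is not isomorphic to any commutative group (e.g. `ℤ/2`). -/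
theorem isEmpty_G_SSSStss_mulEquiv_comm (A : Type*) [CommGroup A] :
    IsEmpty (G RG_SSSStss ≃* A) :=
  isEmpty_mulEquiv_comm RG_SSSStss f_SSSStss relsG_SSSStss 2 3 nc_SSSStss A

/-- `e_w = (g⁻¹y)²`, `w = SSTStts` (length 66): the ι-invariant framing of `C_w`. -/
def e_SSTStts : W :=
  [B, a, E, d, B, e, c, D, D, e, B, a, E, D, b, d, C, B, d, e, A, b, E, b, D, e, B, a, E, d, B,
   e, y, B, a, E, d, B, e, c, D, D, e, B, a, E, D, b, d, C, B, d, e, A, b, E, b, D, e, B, a, E,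
   d, B, e, y]

/-- The new relator for `w = SSTStts`. -/
def S_SSTStts : List W := [e_SSTStts]

/-- Relators of `G_w = π₁(N_{x_*}(γ_w)) / ⟪e⟫`, `w = SSTStts`:
the landed `R_SSTStts`, then `S_SSTStts`. -/
def RG_SSTStts : List W := R_SSTStts ++ S_SSTStts

/-- The landed representation `f_SSTStts` kills the new relators. -/
theorem relsS_SSTStts : ∀ L ∈ S_SSTStts, evalP f_SSTStts L = 1 := by decide

/-- … hence all relators of `RG_SSTStts`. -/
theorem relsG_SSTStts : ∀ L ∈ RG_SSTStts, evalP f_SSTStts L = 1 :=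
  evalP_of_mem_append R_SSTStts S_SSTStts f_SSTStts rels_SSTStts relsS_SSTStts

/-- MAIN (SSTStts): the canonical quotient `G_w`, `w = SSTStts`, is non-commutative — in particular
not `ℤ/2`, so the canonical homology sphere `Σ^ι_w` is not `S³` (REMARK 11.50(iii) of the
residency file). -/
theorem not_comm_G_SSTStts :
    (PresentedGroup.of 2 : G RG_SSTStts) * PresentedGroup.of 3 ≠
      PresentedGroup.of 3 * PresentedGroup.of 2 :=
  of_mul_of_ne RG_SSTStts f_SSTStts relsG_SSTStts 2 3 nc_SSTStts

/-- … hence `G_w` (`w = SSTStts`) is not isomorphic to any commutative group (e.g. `ℤ/2`). -/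
theorem isEmpty_G_SSTStts_mulEquiv_comm (A : Type*) [CommGroup A] :
    IsEmpty (G RG_SSTStts ≃* A) :=
  isEmpty_mulEquiv_comm RG_SSTStts f_SSTStts relsG_SSTStts 2 3 nc_SSTStts A

end CanonicalQuotient
end Summit.SmoothPoincare4.SmoothPoincare4.Theorems
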